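import Summits.ResolutionOfSingularities.ResolutionOfSingularities.Theorems.WeightedInvariantLocalWeightedDropWildPurePowerFlagDropZero

/-!
# `LocalWeightedDrop`, piece S3πM: [HP24, Prop. 4] case (i) on the game side — `y` exceptional, and the swapped `n = 0` flag

Crux item stmt-ResolutionOfSingularities-8899 `LocalWeightedDrop`, class stub S3πM, sub-target `PurePowerFlag.DropStatement` at `t = 0`.
[OURS · L1 W4.3, chain w43, seat res-D-pv-058 acting as res-L1-w43-stub-6; printed mathematics: Hauser–Perlega, PRIMS 60 (2024) Prop. 4 proof
case (i) p. 794–795 ("`E_a = V(xy)`": flags `F₁ = V(z,y)`, `V(z,x)` only; "If `G₁ = V(z,x)` … `s_𝓖` has the minimal value `d_res!`"),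
formalised at series level in `Literature/…/PointBlowupFlagDropExceptionalY` / `…DropMonomialStep`; not a statement of any manuscript.]

Along the axis successor `X 0 ^ q · T = B(x,xy)` of a clean position `B` (`d′_res = d_res ≥ q`):
* `y ∈ E` (only the flag `h = 0`): **`sFlag q T E′ 0 + d! = sFlag q B E 0`** (`sFlag_stepZero_zero_add_factorial`, both `y ∈ E` and `y ∉ E`);
* the letter swap on `ordAlong`, `excExp`, `dRes` (`ordAlong_swap`, `excExp_swap_apply`, `dRes_swap`);
* **the swapped `n = 0` flag of the successor is minimal**: `sFlag q (swap T) (swapE E′) 0 = d_res!` (`sFlag_swap_stepZero_eq_factorial`),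
  `d_res! ≤ sFlag q T E′ 0` (`factorial_le_sFlag_stepZero_zero`), and **every `n = 0` flag triple of the successor of the SECOND
  orientation is beaten** by the triple of the zero shift of the parent (`exists_gt_of_isN0_swap_stepZero`).
-/

set_option linter.dupNamespace false -- mandated namespace of this single-conjunct summit

namespace Summit.ResolutionOfSingularities.ResolutionOfSingularities.Theorems

open Literature.AlgebraicGeometry.Resolution
open Literature.AlgebraicGeometry.Resolution.HauserPerlega2024

namespace PurePowerFlag

open MvPowerSeries

variable {k : Type} [Field k]

/-- the exponent `x^a y^b` at `0`. -/
private theorem g_l (a b : ℕ) : (Finsupp.single (0 : Fin 2) a + Finsupp.single (1 : Fin 2) b : Fin 2 →₀ ℕ) 0 = a := by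
  rw [Finsupp.add_apply, Finsupp.single_eq_same, Finsupp.single_apply, if_neg (by decide), add_zero]

/-- the exponent `x^a y^b` at `1`. -/
private theorem g_r (a b : ℕ) : (Finsupp.single (0 : Fin 2) a + Finsupp.single (1 : Fin 2) b : Fin 2 →₀ ℕ) 1 = b := by
  rw [Finsupp.add_apply, Finsupp.single_eq_same, Finsupp.single_apply, if_neg (by decide), zero_add]

/-- an exponent on two letters is `x^{m 0} y^{m 1}`. -/
private theorem g_ssa (m : Fin 2 →₀ ℕ) : m = Finsupp.single 0 (m 0) + Finsupp.single 1 (m 1) := by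
  ext l
  rcases fin_two_cases l with rfl | rfl
  · rw [g_l]
  · rw [g_r]

/-- the degree on two letters. -/
private theorem g_deg (m : Fin 2 →₀ ℕ) : m.degree = m 0 + m 1 := by
  rw [Finsupp.degree_eq_sum, Fin.sum_univ_two]

/-- rows of the residual factor relative to `x^{r_x} y^{r_y}`. -/
private theorem coeff_residual'' (q : ℕ) (C : MvPowerSeries (Fin 2) k) (E : Finset (Fin 2)) (h : PowerSeries k) (v j : ℕ) :
    coeff (Finsupp.single 0 v + Finsupp.single 1 j) (residual q C E h) =
      coeff (Finsupp.single 0 (excExp C E 0 + v) + Finsupp.single 1 (excExp C E 1 + j)) (expansion q C h) := by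
  have hd : Finsupp.single (0 : Fin 2) v + Finsupp.single 1 j + excExp C E =
      Finsupp.single 0 (excExp C E 0 + v) + Finsupp.single 1 (excExp C E 1 + j) := by
    ext l
    rcases fin_two_cases l with rfl | rfl
    · rw [Finsupp.add_apply, g_l, g_l, add_comm]
    · rw [Finsupp.add_apply, g_r, g_r, add_comm]
  unfold residual
  show coeff (Finsupp.single 0 v + Finsupp.single 1 j + excExp C E) _ = _
  rw [hd]

/-- `s_𝓕` (branch `d_res ≥ q` or `d_res = 0`) as the minimum over the rows of the residual factor. -/
private theorem sFlag_eq_inf'' (q : ℕ) (C : MvPowerSeries (Fin 2) k) (E : Finset (Fin 2)) (h : PowerSeries k)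
    (hq : q ≤ dRes C E ∨ dRes C E = 0) :
    sFlag q C E h = (Finset.range (dRes C E)).inf fun i =>
      (((dRes C E).factorial / (dRes C E - i) : ℕ) : ℕ∞) *
        (PowerSeries.mk fun a => coeff (Finsupp.single 0 a + Finsupp.single 1 i) (residual q C E h)).order := by
  unfold sFlag
  rw [if_pos hq]
  unfold coeffIdealOrder
  rw [← Finset.inf_eq_iInf]
  exact Finset.inf_congr rfl fun i _ => by rw [rowOrder_eq_order_mk]

/-- the order bound `r_x + r_y + d_res ≤ deg`. -/
private theorem exc_add_dRes_le {B : MvPowerSeries (Fin 2) k} (hB : B ≠ 0) (E : Finset (Fin 2)) {m : Fin 2 →₀ ℕ}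
    (hm : coeff m B ≠ 0) : excExp B E 0 + excExp B E 1 + dRes B E ≤ m 0 + m 1 := by
  rw [← order_toNat_eq_excExp_add_dRes hB E]
  have h1 := MvPowerSeries.order_le hm
  rw [← (MvPowerSeries.ne_zero_iff_order_finite).mp hB, g_deg] at h1
  exact_mod_cast h1

/-- a monomial of degree exactly `r_x + r_y + d_res`. -/
private theorem exists_deg_eq {B : MvPowerSeries (Fin 2) k} (hB : B ≠ 0) (E : Finset (Fin 2)) :
    ∃ m, coeff m B ≠ 0 ∧ m 0 + m 1 = excExp B E 0 + excExp B E 1 + dRes B E := by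
  obtain ⟨m₀, hm₀, hdeg⟩ := MvPowerSeries.exists_coeff_ne_zero_and_order ((MvPowerSeries.ne_zero_iff_order_finite).mp hB)
  refine ⟨m₀, hm₀, ?_⟩
  rw [← order_toNat_eq_excExp_add_dRes hB E]
  have h2 : ((m₀ 0 + m₀ 1 : ℕ) : ℕ∞) = (B.order.toNat : ℕ∞) := by
    rw [← g_deg, hdeg, (MvPowerSeries.ne_zero_iff_order_finite).mp hB]
  exact_mod_cast h2

/-! ### The flag `h = 0` of the successor against the flag `h = 0` of the parent (rows relative to `x^{r_x} y^{r_y}`) -/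

/-- the rows of the residual factor along the ZERO shift of a clean `C` are the rows of `C` relative to `x^{r_x} y^{r_y}`. -/
theorem coeff_row_residual_zero (q : ℕ) {C : MvPowerSeries (Fin 2) k} (hC : cleanSeries q C = C) (E : Finset (Fin 2)) (j v : ℕ) :
    PowerSeries.coeff v (PowerSeries.mk fun a => coeff (Finsupp.single 0 a + Finsupp.single 1 j) (residual q C E 0)) =
      coeff (Finsupp.single 0 (excExp C E 0 + v) + Finsupp.single 1 (excExp C E 1 + j)) C := by
  rw [PowerSeries.coeff_mk, coeff_residual'', expansion_zero, hC]

/-- the successor exponents: `r′_x + q = r_x + r_y + d_res` and `r′_y = r_y` (letters `E′ ∋ x`, `y ∈ E′ ↔ y ∈ E`). -/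
theorem excExp_stepZero (q : ℕ) {B T : MvPowerSeries (Fin 2) k} (hB0 : B ≠ 0) (hqo : ((q : ℕ) : ℕ∞) ≤ B.order)
    (hT : (X 0 : MvPowerSeries (Fin 2) k) ^ q * T = subst (PlaneGerm.dirChart (0 : k)) B) {E E' : Finset (Fin 2)}
    (h0 : (0 : Fin 2) ∈ E') (h1 : (1 : Fin 2) ∈ E' ↔ (1 : Fin 2) ∈ E) :
    excExp T E' 0 + q = excExp B E 0 + excExp B E 1 + dRes B E ∧ excExp T E' 1 = excExp B E 1 := by
  have hfin := (MvPowerSeries.ne_zero_iff_order_finite).mp hB0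
  have hqo' : q ≤ B.order.toNat := by rw [← hfin] at hqo; exact_mod_cast hqo
  constructor
  · rw [← order_toNat_eq_excExp_add_dRes hB0 E]
    have h2 : ((excExp T E' 0 : ℕ) : ℕ∞) = ((B.order.toNat - q : ℕ) : ℕ∞) := by
      rw [excExp_apply, if_pos h0, ordAlong_zero_stepZero q hB0 hqo hT, ENat.toNat_coe]
    have h3 : excExp T E' 0 = B.order.toNat - q := by exact_mod_cast h2
    omega
  · rw [excExp_apply, excExp_apply, ordAlong_one_stepZero q hT]
    by_cases hy : (1 : Fin 2) ∈ E
    · rw [if_pos (h1.mpr hy), if_pos hy]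
    · rw [if_neg (fun h => hy (h1.mp h)), if_neg hy]

/-- **[HP24, Prop. 4 (i)], the flag `F₁ = V(z, y)` on both sides: `sFlag q T E′ 0 + d_res! = sFlag q B E 0`** when `d′_res = d_res ≥ q`
(`E_a = V(xy)` allowed: rows relative to `x^{r_x} y^{r_y}`). [HP24 Prop. 4 (i) p. 794 l. 36 – p. 795 l. 5] -/
theorem sFlag_stepZero_zero_add_factorial (q : ℕ) {B T : MvPowerSeries (Fin 2) k} (hB : cleanSeries q B = B) (hB0 : B ≠ 0)
    (hqo : ((q : ℕ) : ℕ∞) ≤ B.order) (hT : (X 0 : MvPowerSeries (Fin 2) k) ^ q * T = subst (PlaneGerm.dirChart (0 : k)) B)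
    {E E' : Finset (Fin 2)} (h0 : (0 : Fin 2) ∈ E') (h1 : (1 : Fin 2) ∈ E' ↔ (1 : Fin 2) ∈ E) (hq : q ≤ dRes B E)
    (hd : dRes T E' = dRes B E) :
    sFlag q T E' 0 + ((dRes B E).factorial : ℕ∞) = sFlag q B E 0 := by
  classical
  have hTc := cleanSeries_of_stepZero q hB hT
  have hT' := hT
  rw [subst_dirChart_zero_eq] at hT'
  obtain ⟨hrx, hry⟩ := excExp_stepZero q hB0 hqo hT h0 h1
  have hmin : ∀ m, coeff m B ≠ 0 → excExp B E 0 + excExp B E 1 + dRes B E ≤ m 0 + m 1 := fun m hm => exc_add_dRes_le hB0 E hm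
  have hmain := inf_rows_step_add_factorial_xy q 0 1 zero_ne_one_fin fin_two_cases B T hT' (excExp B E 0) (excExp T E' 0)
    (excExp B E 1) (dRes B E) hrx hmin _ _ (coeff_row_residual_zero q hB E) (fun j v => by
      rw [coeff_row_residual_zero q hTc E', hry])
  rw [sFlag_eq_inf'' q T E' 0 (Or.inl (by rw [hd]; exact hq)), sFlag_eq_inf'' q B E 0 (Or.inl hq), hd]
  exact hmain

/-- **`d_res! ≤ sFlag q T E′ 0`** for the successor when `d′_res = d_res ≥ q`. [HP24 Prop. 4 (i) p. 794 l. 43–45] -/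
theorem factorial_le_sFlag_stepZero_zero (q : ℕ) {B T : MvPowerSeries (Fin 2) k} (hB : cleanSeries q B = B) (hB0 : B ≠ 0)
    (hT : (X 0 : MvPowerSeries (Fin 2) k) ^ q * T = subst (PlaneGerm.dirChart (0 : k)) B) {E E' : Finset (Fin 2)}
    (hq : q ≤ dRes B E) (hd : dRes T E' = dRes B E) :
    ((dRes B E).factorial : ℕ∞) ≤ sFlag q T E' 0 := by
  classical
  have hTc := cleanSeries_of_stepZero q hB hT
  have hT0 := ne_zero_stepZero q hB0 hT
  rw [sFlag_eq_inf'' q T E' 0 (Or.inl (by rw [hd]; exact hq)), hd]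
  refine factorial_le_inf_rows _ fun i a hne => ?_
  rw [coeff_row_residual_zero q hTc E'] at hne
  have := exc_add_dRes_le hT0 E' hne
  rw [g_l, g_r, hd] at this
  omega

/-! ### The letter swap on the exponents -/

/-- `ord_{X i}(swap B) = ord_{X (swap i)} B`. -/
theorem ordAlong_swap (i : Fin 2) (B : MvPowerSeries (Fin 2) k) : ordAlong i (swap B) = ordAlong (Equiv.swap (0 : Fin 2) 1 i) B := by
  unfold ordAlong
  apply le_antisymm
  · refine le_iInf₂ fun d hd => ?_
    have hne : swap B (Finsupp.equivMapDomain (Equiv.swap (0 : Fin 2) 1) d) ≠ 0 := by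
      rw [← MvPowerSeries.coeff_apply (swap B), coeff_swap]
      have : Finsupp.equivMapDomain (Equiv.swap (0 : Fin 2) 1) (Finsupp.equivMapDomain (Equiv.swap (0 : Fin 2) 1) d) = d := by
        ext j; simp only [Finsupp.equivMapDomain_apply, Equiv.symm_swap, Equiv.swap_apply_self]
      rw [this, MvPowerSeries.coeff_apply]; exact hd
    refine le_trans (iInf₂_le (Finsupp.equivMapDomain (Equiv.swap (0 : Fin 2) 1) d) hne) (le_of_eq ?_)
    simp only [Finsupp.equivMapDomain_apply, Equiv.symm_swap]
  · refine le_iInf₂ fun d hd => ?_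
    have hne : B (Finsupp.equivMapDomain (Equiv.swap (0 : Fin 2) 1) d) ≠ 0 := by
      rw [← MvPowerSeries.coeff_apply B, ← coeff_swap, MvPowerSeries.coeff_apply]; exact hd
    refine le_trans (iInf₂_le (Finsupp.equivMapDomain (Equiv.swap (0 : Fin 2) 1) d) hne) (le_of_eq ?_)
    simp only [Finsupp.equivMapDomain_apply, Equiv.symm_swap, Equiv.swap_apply_self]

/-- the exceptional exponent of the swap, letter by letter. -/
theorem excExp_swap_apply (B : MvPowerSeries (Fin 2) k) (E : Finset (Fin 2)) (i : Fin 2) :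
    excExp (swap B) (swapE E) i = excExp B E (Equiv.swap (0 : Fin 2) 1 i) := by
  rw [excExp_apply, excExp_apply, ordAlong_swap]
  simp only [mem_swapE]

/-- **the residual order is swap-invariant**. -/
theorem dRes_swap (B : MvPowerSeries (Fin 2) k) (E : Finset (Fin 2)) : dRes (swap B) (swapE E) = dRes B E := by
  by_cases hB : B = 0
  · subst hB
    have : swap (0 : MvPowerSeries (Fin 2) k) = 0 := map_zero _
    unfold dRes; rw [this]
    simp [ordAlong]
  · have h1 := order_toNat_eq_excExp_add_dRes hB E
    have h2 := order_toNat_eq_excExp_add_dRes (swap_ne_zero hB) (swapE E)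
    rw [order_swap, excExp_swap_apply, excExp_swap_apply, Equiv.swap_apply_left, Equiv.swap_apply_right] at h2
    omega

/-! ### The swapped `n = 0` flag of the successor: "If `G₁ = V(z,x)` … `s_𝓖 = d_res!`" -/

/-- the rows of the residual factor of the SWAP along the zero shift are the COLUMNS of the series relative to `x^{r_x}y^{r_y}`. -/
theorem coeff_row_residual_swap_zero (q : ℕ) {C : MvPowerSeries (Fin 2) k} (hC : cleanSeries q C = C) (E : Finset (Fin 2)) (j v : ℕ) :
    PowerSeries.coeff v (PowerSeries.mk fun a => coeff (Finsupp.single 0 a + Finsupp.single 1 j) (residual q (swap C) (swapE E) 0)) =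
      coeff (Finsupp.single 0 (excExp C E 0 + j) + Finsupp.single 1 (excExp C E 1 + v)) C := by
  rw [coeff_row_residual_zero q (by rw [cleanSeries_swap, hC]) (swapE E), excExp_swap_apply, excExp_swap_apply,
    Equiv.swap_apply_left, Equiv.swap_apply_right, coeff_swap]
  have hd : Finsupp.equivMapDomain (Equiv.swap (0 : Fin 2) 1)
      (Finsupp.single (0 : Fin 2) (excExp C E 1 + v) + Finsupp.single 1 (excExp C E 0 + j)) =
      Finsupp.single 0 (excExp C E 0 + j) + Finsupp.single 1 (excExp C E 1 + v) := by
    ext l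
    rcases fin_two_cases l with rfl | rfl
    · rw [Finsupp.equivMapDomain_apply, Equiv.symm_swap, Equiv.swap_apply_left, g_l, g_r]
    · rw [Finsupp.equivMapDomain_apply, Equiv.symm_swap, Equiv.swap_apply_right, g_l, g_r]
  rw [hd]

/-- **"If `G₁ = V(z,x)` and `d_res ≥ pᵉ`, the numeral `s_𝓖` hence has the minimal value `s_𝓖 = d_res!`"** on the game side: along the axis
successor with `d′_res = d_res ≥ q ≥ 1`, `sFlag q (swap T) (swapE E′) 0 = d_res!`. [HP24 Prop. 4 (i) p. 794 l. 40–45] -/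
theorem sFlag_swap_stepZero_eq_factorial (q : ℕ) (hq1 : 1 ≤ q) {B T : MvPowerSeries (Fin 2) k} (hB : cleanSeries q B = B) (hB0 : B ≠ 0)
    (hqo : ((q : ℕ) : ℕ∞) ≤ B.order) (hT : (X 0 : MvPowerSeries (Fin 2) k) ^ q * T = subst (PlaneGerm.dirChart (0 : k)) B)
    {E E' : Finset (Fin 2)} (h0 : (0 : Fin 2) ∈ E') (h1 : (1 : Fin 2) ∈ E' ↔ (1 : Fin 2) ∈ E) (hq : q ≤ dRes B E)
    (hd : dRes T E' = dRes B E) :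
    sFlag q (swap T) (swapE E') 0 = ((dRes B E).factorial : ℕ∞) := by
  classical
  have hTc := cleanSeries_of_stepZero q hB hT
  have hT0 := ne_zero_stepZero q hB0 hT
  have hT' := hT
  rw [subst_dirChart_zero_eq] at hT'
  obtain ⟨hrx, hry⟩ := excExp_stepZero q hB0 hqo hT h0 h1
  set d := dRes B E with hdd
  set rx := excExp B E 0 with hrxd
  set ry := excExp B E 1 with hryd
  set rx' := excExp T E' 0 with hrx'd
  have hd1 : 0 < d := by omega
  rw [sFlag_eq_inf'' q (swap T) (swapE E') 0 (Or.inl (by rw [dRes_swap, hd]; exact hq)), dRes_swap, hd]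
  set Col : ℕ → PowerSeries k := fun i => PowerSeries.mk fun a =>
    coeff (Finsupp.single 0 a + Finsupp.single 1 i) (residual q (swap T) (swapE E') 0) with hCol
  have hColv : ∀ i v, PowerSeries.coeff v (Col i) = coeff (Finsupp.single 0 (rx' + i) + Finsupp.single 1 (ry + v)) T := by
    intro i v
    rw [hCol]
    dsimp only
    rw [coeff_row_residual_swap_zero q hTc E', hry]
  have hmin : ∀ i a, PowerSeries.coeff a (Col i) ≠ 0 → d ≤ i + a := by
    intro i a hne
    rw [hColv] at hne
    have := exc_add_dRes_le hT0 E' hne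
    rw [g_l, g_r, hd, hry] at this
    omega
  -- the corner `c_d y^d` of `G′`
  have hn : ∀ m, coeff m B ≠ 0 → Finsupp.single 0 rx + Finsupp.single 1 ry ≤ m := fun m hm => by
    have := excExp_le_of_coeff_ne_zero B E hm
    rwa [g_ssa (excExp B E)] at this
  have hex : ∃ m, coeff m B ≠ 0 ∧ m 0 + m 1 = rx + ry + d := exists_deg_eq hB0 E
  have hmin' : ∀ m, coeff m T ≠ 0 → rx' + ry + d ≤ m 0 + m 1 := fun m hm => by
    have := exc_add_dRes_le hT0 E' hm; rw [hry, hd] at this; exact this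
  set R : ℕ → PowerSeries k := fun j => PowerSeries.mk fun v =>
    coeff (Finsupp.single 0 (rx + v) + Finsupp.single 1 (ry + j)) B with hRdef
  set R' : ℕ → PowerSeries k := fun j => PowerSeries.mk fun v =>
    coeff (Finsupp.single 0 (rx' + v) + Finsupp.single 1 (ry + j)) T with hR'def
  have hcorner := corner_ne_zero_of_step_xy q 0 1 zero_ne_one_fin fin_two_cases B T hT' rx rx' ry d hrx hn hex hmin' R R'
    (fun j v => by rw [hRdef, PowerSeries.coeff_mk]) (fun j v => by rw [hR'def, PowerSeries.coeff_mk])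
  rw [hR'def, PowerSeries.coeff_mk, Nat.add_zero] at hcorner
  have hcorner' : PowerSeries.coeff d (Col 0) ≠ 0 := by rw [hColv, Nat.add_zero]; exact hcorner
  exact le_antisymm (inf_rows_le_factorial_of_coeff_ne_zero Col hd1 (by omega) hcorner') (factorial_le_inf_rows Col hmin)

/-- **[HP24, Prop. 4] case (i), SECOND ORIENTATION, ON THE GAME SIDE**: along the axis successor of a clean position with `d_res ≥ q ≥ 1`,
every `n = 0` flag of the successor in the swapped orientation (necessarily the flag `V(z, x)`, `h = 0`) is strictly dominated by the
flag triple of the zero shift of the parent: either `d′_res < d_res`, or `s_𝓖 = d_res! < 2·d_res! ≤ s_{(B,E,0)}`.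
[HP24 Prop. 4 (i) p. 794 l. 30–45] -/
theorem exists_gt_of_isN0_swap_stepZero (q : ℕ) (hq1 : 1 ≤ q) {B T : MvPowerSeries (Fin 2) k} (hB : cleanSeries q B = B)
    (hB0 : B ≠ 0) (hqo : ((q : ℕ) : ℕ∞) ≤ B.order)
    (hT : (X 0 : MvPowerSeries (Fin 2) k) ^ q * T = subst (PlaneGerm.dirChart (0 : k)) B) {E E' : Finset (Fin 2)}
    (h0 : (0 : Fin 2) ∈ E') (h1 : (1 : Fin 2) ∈ E' ↔ (1 : Fin 2) ∈ E) (hq : q ≤ dRes B E) (h : PowerSeries k)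
    (hN : IsN0 (swapE E') h) :
    ∃ v : Triple, IsFlagTriple q B E v ∧ flagTriple q (swap T) (swapE E') h < v := by
  classical
  have hh : h = 0 := hN.resolve_left (fun hne => hne ((mem_swapE E' 1).mpr (by
    rw [Equiv.swap_apply_right]; exact h0)))
  subst hh
  refine ⟨flagTriple q B E 0, isFlagTriple_zero q B E, ?_⟩
  rw [flagTriple_of_isN0 q (swap T) hN, flagTriple_of_isN0 q B (Or.inr rfl), dRes_swap, Prod.Lex.toLex_lt_toLex]
  rcases (dRes_stepZero_le q hB0 hqo hT h0 h1).lt_or_eq with hlt | heq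
  · left; exact hlt
  · right
    refine ⟨heq, ?_⟩
    rw [Prod.Lex.toLex_lt_toLex]
    right
    refine ⟨rfl, ?_⟩
    show sFlag q (swap T) (swapE E') 0 < sFlag q B E 0
    rw [sFlag_swap_stepZero_eq_factorial q hq1 hB hB0 hqo hT h0 h1 hq heq,
      ← sFlag_stepZero_zero_add_factorial q hB hB0 hqo hT h0 h1 hq heq]
    have hfac := factorial_le_sFlag_stepZero_zero q hB hB0 hT hq heq (E := E) (E' := E')
    have hpos : ((dRes B E).factorial : ℕ∞) ≠ 0 := by exact_mod_cast (Nat.factorial_pos _).ne'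
    calc ((dRes B E).factorial : ℕ∞) < ((dRes B E).factorial : ℕ∞) + ((dRes B E).factorial : ℕ∞) := by
          rw [← Nat.cast_add, Nat.cast_lt]; have := Nat.factorial_pos (dRes B E); omega
      _ ≤ sFlag q T E' 0 + ((dRes B E).factorial : ℕ∞) := add_le_add hfac le_rfl

end PurePowerFlag

end Summit.ResolutionOfSingularities.ResolutionOfSingularities.Theorems
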